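import Literature.RepresentationTheory.MoeglinVignerasWaldspurger1987.RankOneThetaLiftTwistReductionSplit
import Literature.NumberTheory.Automorphic.Zelevinsky1980.InducedCharacterRigidity
import Literature.NumberTheory.Automorphic.SmoothInductionCharacterTwist
import Literature.NumberTheory.Automorphic.Liu2021.LemD1SplitPlaceOfFacts
import Literature.NumberTheory.Automorphic.ParabolicInduction
import HarnessLib

/-!
# Row IV-4c4 `rankOne_theta_twist_rigidity_split` from the UNIFORM split-place model: rigidity of the unitary inducing datum

Topic `RepresentationTheory/MoeglinVignerasWaldspurger1987`; THEOREMS ONLY (no definition, no named fact, no `sorry`).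
We prove the named fact `rankOne_theta_twist_rigidity_split` (`RankOneThetaLiftTwistRigiditySplit.lean`: at a split place two
splittings `s₁, s₂` over `ι` with smooth `L²`-isometric Weil representations and `Θ_{s₁}(χ₁) ≅ Θ_{s₂}(χ₂) ≠ 0` are equal) FROM
the split-place model of row IV-3(a) in its UNIFORM form — the typed fact `Liu2021.splitPlace_chiCoinv_iso_parabolicIndGL`
(p590532) with the existential `∃ ν` moved in front of `∀ χ`: **for every section `s` there is ONE unitary continuous `ν = ν(s)`
such that for every unitary continuous `χ` the `χ`-coinvariants `Θ_s(χ)`, read on `GL_N(E_w)` through `localPiSplitEquiv`, are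
isomorphic to `(ν ∘ det_{GL_{N-1}}) × χ′ν^{1-N}` for some unitary continuous `χ′`** (hypothesis `hM` below; this is what the
printed proof [Liu2021, App. D, split case, l. 5249–5253] uses: «identify `U(V)` with `GL_n(F)` through the first factor and write
`μ = ν ⊠ ν⁻¹`» — `ν` is read off the splitting, not off `χ`; the typed ∃∀-weakening does not suffice, see the PREP memo of seat
B-p17).  Assembly (`rankOne_theta_twist_rigidity_split_of_uniformModel`):

1. `RankOneThetaLiftTwistReductionSplit`: it suffices to show, for ONE section `s` (smooth, `L²`-isometric), a UNITARY open-kernel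
   character `η` of `U(J)(F_v)` and unitary continuous `χ, χ′`, that `Θ_s(χ) ≅ η ⊗ Θ_s(χ′) ≠ 0` forces `η = 1`;
2. read everything on `GL₃(E_w)` through `κ = localPiSplitEquiv` (split `v`: a place `w ∣ v` moved by `c`,
   `Liu2021.SplitPlace.exists_placesOver_smul_ne_of_not_isField`): `η ∘ κ⁻¹ = θ₀ ∘ det` with `θ₀` unitary of open kernel
   (`exists_eq_comp_det_of_character`, `SmoothInductionCharacterTwist`);
3. `hM` at `χ` and at `χ′` with the SAME `ν`: `Θ_s(χ) ∘ κ⁻¹ ≅ I(ν, b₁)`, `Θ_s(χ′) ∘ κ⁻¹ ≅ I(ν, b₂)`; twisting,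
   `(θ₀∘det) ⊗ I(ν, b₂) ≅ I(νθ₀, b₂θ₀)` (`Zelevinsky1980.areIsomorphicRep_twist_det_parabolicIndGL_detChar`), so
   `I(ν, b₁) ≅ I(νθ₀, b₂θ₀)`;
4. RIGIDITY of the unitary inducing datum for `N = 3` (`Zelevinsky1980.eq_of_areIsomorphicRep_parabolicIndGL_detChar`,
   `InducedCharacterRigidity`: Bernstein–Zelevinsky's two `(Q_{2,1}, Q_{2,1})`-orbits have different `d(ϖ)`-exponents) gives
   `ν = νθ₀`, so `θ₀ = 1`, `η = 1`.

Cell hodgecm-mathlib, row IV-4c4 (binder `HypD3`, split places); the result is CONDITIONAL on `hM` (an explicit `∀`-hypothesis,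
the uniform form of row IV-3(a) — to be discharged by the IV-3(a) programme, seat B-p08), nothing else; HC_CM is proved only
modulo the printed citations until rung 0 closes.

## References
* [Liu2021] Y. Liu, Camb. J. Math. 9 (2021) = arXiv:2102.11518 — App. D Lem. D.1 (3) (l. 5233); proof, split case (l. 5249–5254).
* [Minguez2008] A. Mínguez, Ann. Sci. ÉNS 41 (2008) — Thm. 1 p. 718 (explicit type II theta), §6 (uniqueness of Langlands data).
* [BernsteinZelevinskyASENS1977] I. N. Bernstein, A. V. Zelevinsky, Ann. Sci. ÉNS 10 (1977) — Thm. 5.2, §7.1.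
-/

noncomputable section

namespace Literature.RepresentationTheory.MoeglinVignerasWaldspurger1987

open NumberField IsDedekindDomain
open scoped Matrix
open _root_.MeasureTheory
open Literature.RepresentationTheory (SeesawScalar.twist SeesawScalar.twist_apply)
open Literature.RepresentationTheory.HeisenbergGroup
open Literature.NumberTheory.GelbartRogawski1991.UnitaryDualPair.LocalSplitting
open Literature.NumberTheory.Automorphic
open Literature.NumberTheory.Automorphic.UnitaryGroup
open Literature.NumberTheory.Automorphic.Liu2021

/-- `χ′ ν^k` is unitary and continuous (as a `ℂ`-valued function) for unitary continuous `ν, χ′`. [folklore] -/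
private theorem unitary_continuous_mul_zpow {K : Type*} [TopologicalSpace K] [Monoid K] (ν χ' : K →* ℂˣ)
    (hνu : ∀ x, ‖((ν x : ℂˣ) : ℂ)‖ = 1) (hνc : Continuous fun x => ((ν x : ℂˣ) : ℂ))
    (hχ'u : ∀ x, ‖((χ' x : ℂˣ) : ℂ)‖ = 1) (hχ'c : Continuous fun x => ((χ' x : ℂˣ) : ℂ)) (k : ℤ) :
    (∀ x, ‖(((χ' * ν ^ k) x : ℂˣ) : ℂ)‖ = 1) ∧ Continuous fun x => (((χ' * ν ^ k) x : ℂˣ) : ℂ) := by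
  have h : (fun x => (((χ' * ν ^ k) x : ℂˣ) : ℂ)) = fun x => ((χ' x : ℂˣ) : ℂ) * ((ν x : ℂˣ) : ℂ) ^ k := by
    funext x
    rw [MonoidHom.mul_apply, MonoidHom.zpow_apply, Units.val_mul, Units.val_zpow_eq_zpow_val]
  refine ⟨fun x => ?_, ?_⟩
  · rw [MonoidHom.mul_apply, MonoidHom.zpow_apply, Units.val_mul, Units.val_zpow_eq_zpow_val, norm_mul, norm_zpow, hχ'u, hνu,
      one_zpow, one_mul]
  · rw [h]
    exact hχ'c.mul (hνc.zpow₀ k fun x => Or.inl (Units.ne_zero _))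

/-- `χ′ θ` is unitary for unitary `χ′, θ`. [folklore] -/
private theorem unitary_mul {K : Type*} [Monoid K] (χ' θ : K →* ℂˣ) (hχ'u : ∀ x, ‖((χ' x : ℂˣ) : ℂ)‖ = 1)
    (hθu : ∀ x, ‖((θ x : ℂˣ) : ℂ)‖ = 1) (x : K) : ‖(((χ' * θ) x : ℂˣ) : ℂ)‖ = 1 := by
  rw [MonoidHom.mul_apply, Units.val_mul, norm_mul, hχ'u, hθu, one_mul]

/-- Pulling an isomorphism `ρ₁ ≅ η ⊗ ρ₂` back along a homomorphism `φ`: `ρ₁ ∘ φ ≅ θ ⊗ (ρ₂ ∘ φ)` for `θ = η ∘ φ`. [folklore] -/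
private theorem areIsomorphicRep_comp_twist {G G' V₁ V₂ : Type*} [Group G] [Group G'] [AddCommGroup V₁] [Module ℂ V₁]
    [AddCommGroup V₂] [Module ℂ V₂] {ρ₁ : Representation ℂ G V₁} {ρ₂ : Representation ℂ G V₂} (η : G →* ℂˣ)
    (h : AreIsomorphicRep ρ₁ (SeesawScalar.twist η ρ₂)) (φ : G' →* G) (θ : G' →* ℂˣ) (hθ : θ = η.comp φ) :
    AreIsomorphicRep (ρ₁.comp φ) (SeesawScalar.twist θ (ρ₂.comp φ)) := by
  subst hθ
  obtain ⟨f, hf⟩ := h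
  exact ⟨f, fun g v => hf (φ g) v⟩

/-- «isomorphic» passes to twists, along an equation of characters. [folklore] -/
private theorem areIsomorphicRep_twist_congr' {G V₁ V₂ : Type*} [Group G] [AddCommGroup V₁] [Module ℂ V₁] [AddCommGroup V₂]
    [Module ℂ V₂] {ρ₁ : Representation ℂ G V₁} {ρ₂ : Representation ℂ G V₂} (h : AreIsomorphicRep ρ₁ ρ₂) (θ θ' : G →* ℂˣ)
    (hθ : θ = θ') : AreIsomorphicRep (SeesawScalar.twist θ ρ₁) (SeesawScalar.twist θ' ρ₂) := by
  subst hθ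
  obtain ⟨f, hf⟩ := h
  exact ⟨f, fun g v => by rw [SeesawScalar.twist_apply, SeesawScalar.twist_apply, map_smul, hf]⟩

/-- **Row IV-4c4 from the UNIFORM split-place model.**  If for every splitting `s` of `U(J)(F_v)` over `ι` at a split place
(smooth, `L²`-isometric Weil representation) there is ONE unitary continuous `ν` such that for EVERY unitary continuous character `χ`
of the centre `Θ_s(χ) ∘ κ⁻¹ ≅ (ν∘det) × χ′ν^{1-N}` for some unitary continuous `χ′` (`κ = localPiSplitEquiv`; the typed fact
`Liu2021.splitPlace_chiCoinv_iso_parabolicIndGL` with `∃ ν` before `∀ χ`), then `rankOne_theta_twist_rigidity_split` holds: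
by `rankOne_theta_twist_rigidity_split_of_twistRigid` it suffices that `Θ_s(χ) ≅ η ⊗ Θ_s(χ′) ≠ 0` with `η` unitary of open
kernel forces `η = 1`; on `GL₃(E_w)`, `η ∘ κ⁻¹ = θ₀ ∘ det` and `(θ₀∘det) ⊗ I(ν, b₂) ≅ I(νθ₀, b₂θ₀)`, so `I(ν, b₁) ≅ I(νθ₀, b₂θ₀)` and
the rigidity of the unitary inducing datum (`Zelevinsky1980.eq_of_areIsomorphicRep_parabolicIndGL_detChar`) gives `ν = νθ₀`,
`θ₀ = 1`, `η = 1`. [cite: Liu2021, App. D Lemma D.1 (3) (l. 5233) and proof, split case (l. 5249–5254)]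
[cite: Minguez2008, Thm. 1 p. 718 and §6 p. 733] -/
theorem rankOne_theta_twist_rigidity_split_of_uniformModel
    (hM : ∀ (F : Type) [Field F] [NumberField F] (E : Type) [Field E] [NumberField E] [Algebra F E]
      [Algebra.IsQuadraticExtension F E] (c : E ≃ₐ[F] E) (hc1 : c ≠ 1) (N : ℕ) (_hN : 2 ≤ N) (δ : E) (hcδ : c δ = -δ)
      (hδ : δ ≠ 0) (d : F) (hd : δ * δ = algebraMap F E d) (T : Matrix (Fin N) (Fin N) F) (hT : T.IsSymm) (_hTd : IsUnit T.det)
      (J : Matrix (Fin N) (Fin N) E) (hJ : J = T.map (algebraMap F E)) (hJh : (J.map c)ᵀ = J)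
      (v : HeightOneSpectrum (𝓞 F)) (w : UnitaryGroup.PlacesOver E v) (hw : c • (w : HeightOneSpectrum (𝓞 E)) ≠ w)
      (hJw : IsUnit (UnitaryGroup.placeForm J (w : HeightOneSpectrum (𝓞 E))))
      [MeasurableSpace (v.adicCompletion F)] [BorelSpace (v.adicCompletion F)]
      (μX : Measure (Fin N → v.adicCompletion F)) [μX.IsAddHaarMeasure]
      (s : UnitaryGroup.localPi E c N J v →* LocalMp F N T v)
      (_hs : ∀ g, MpPsi.proj _ (s g) = iota F E c N hcδ hδ hd T hT hJ v g)
      (_hsm : Representation.IsSmooth ((MpPsi.toRep (localSchrodinger F N T v)).comp s))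
      (_hsu : Representation.IsL2Isometric μX ((MpPsi.toRep (localSchrodinger F N T v)).comp s))
      (J₁ : Matrix (Fin 1) (Fin 1) E) (hJ₁ : J₁ 0 0 ≠ 0)
      [LocallyCompactSpace (standardParabolicGL ((w : HeightOneSpectrum (𝓞 E)).adicCompletion E)
        (Zelevinsky1980.lastBlockLabel N))],
      ∃ ν : ((w : HeightOneSpectrum (𝓞 E)).adicCompletion E)ˣ →* ℂˣ,
        (∀ x, ‖((ν x : ℂˣ) : ℂ)‖ = 1) ∧ (Continuous fun x => ((ν x : ℂˣ) : ℂ)) ∧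
        ∀ (χ : UnitaryGroup.localPi E c 1 J₁ v →* ℂˣ) (_hχu : ∀ z, ‖((χ z : ℂˣ) : ℂ)‖ = 1)
          (_hχc : Continuous fun z => ((χ z : ℂˣ) : ℂ)),
          ∃ χ' : ((w : HeightOneSpectrum (𝓞 E)).adicCompletion E)ˣ →* ℂˣ,
            (∀ x, ‖((χ' x : ℂˣ) : ℂ)‖ = 1) ∧ (Continuous fun x => ((χ' x : ℂˣ) : ℂ)) ∧
            AreIsomorphicRep
              ((TwistedCoinv.rep
                (ρW := show Representation ℂ (UnitaryGroup.localPi E c 1 J₁ v) (SchwartzBruhat (Fin N → v.adicCompletion F)) from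
                  ((MpPsi.toRep (localSchrodinger F N T v)).comp s).comp (UnitaryGroup.localCenter E c N J J₁ hJ₁ v))
                χ ((MpPsi.toRep (localSchrodinger F N T v)).comp s)
                (fun g z => (show Commute g (UnitaryGroup.localCenter E c N J J₁ hJ₁ v z) from
                  UnitaryGroup.localCenter_comm E c N J J₁ hJ₁ v z g).map ((MpPsi.toRep (localSchrodinger F N T v)).comp s))).comp
                (UnitaryGroup.localPiSplitEquiv c J hc1 hJh w hw hJw).symm.toMonoidHom)
              (Representation.parabolicIndGL ((w : HeightOneSpectrum (𝓞 E)).adicCompletion E) (Zelevinsky1980.lastBlockLabel N)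
                ((Representation.trivial ℂ (Π a : Bool, GL {i : Fin N // Zelevinsky1980.lastBlockLabel N i = a}
                    ((w : HeightOneSpectrum (𝓞 E)).adicCompletion E)) ℂ).twist
                  (Zelevinsky1980.maxParabolicLeviChar ((w : HeightOneSpectrum (𝓞 E)).adicCompletion E) N ν
                    (χ' * ν ^ (1 - (N : ℤ))))))) :
    rankOne_theta_twist_rigidity_split := by
  refine rankOne_theta_twist_rigidity_split_of_twistRigid ?_
  intro F _ _ E _ _ _ _ c δ hcδ hδ d hd T hT hTd J hJ v hE _ _ μ' _ s hs hsm hL2 η hηo hηu J₁ hJ₁ χ χ' hχu hχc hχ'u hχ'c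
    hnt hiso
  classical
  /- §0 the split place: `c ≠ 1`, a place `w ∣ v` moved by `c`, `J` hermitian and invertible at `w` -/
  haveI := secondCountableTopology_adicCompletion F v
  haveI : (Measure.pi fun _ : Fin 3 => μ').IsAddHaarMeasure := Measure.pi.isAddHaarMeasure _
  have hc1 : c ≠ 1 := UnitaryGroup.algEquiv_ne_one_of_apply_eq_neg F E c hcδ hδ
  obtain ⟨w, hw⟩ := SplitPlace.exists_placesOver_smul_ne_of_not_isField E v c hc1 hE
  have hJh : (J.map c)ᵀ = J := by
    have hc' : (c : E → E) ∘ (algebraMap F E) = algebraMap F E := funext fun x => c.commutes x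
    rw [hJ, Matrix.map_map, hc', ← Matrix.transpose_map, hT.eq]
  have hJu : IsUnit J := by
    rw [Matrix.isUnit_iff_isUnit_det, hJ, ← RingHom.mapMatrix_apply, ← RingHom.map_det]
    exact hTd.map _
  have hJw : IsUnit (placeForm J w.1) := isUnit_placeForm _ hJu w.1
  /- §1 the uniform model for `s`: one `ν`, and the readings at `χ` and at `χ′` -/
  obtain ⟨ν, hνu, hνc, hν⟩ := hM F E c hc1 3 (by norm_num) δ hcδ hδ d hd T hT hTd J hJ hJh v w hw hJw
    (Measure.pi fun _ : Fin 3 => μ') s hs hsm hL2 J₁ hJ₁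
  obtain ⟨a₁, ha₁u, ha₁c, h₁⟩ := hν χ hχu hχc
  obtain ⟨a₂, ha₂u, ha₂c, h₂⟩ := hν χ' hχ'u hχ'c
  obtain ⟨hb₁u, hb₁c⟩ := unitary_continuous_mul_zpow ν a₁ hνu hνc ha₁u ha₁c (1 - (3 : ℤ))
  obtain ⟨hb₂u, hb₂c⟩ := unitary_continuous_mul_zpow ν a₂ hνu hνc ha₂u ha₂c (1 - (3 : ℤ))
  /- §2 read `η` on `GL₃(E_w)`: `θ = η ∘ κ⁻¹ = θ₀ ∘ det`, `θ₀` unitary with open kernel -/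
  obtain ⟨θ, hθ⟩ : ∃ θ : GL (Fin 3) (w.1.adicCompletion E) →* ℂˣ,
      θ = η.comp (localPiSplitEquiv c J hc1 hJh w hw hJw).symm.toMonoidHom := ⟨_, rfl⟩
  have hθ_apply : ∀ g, θ g = η ((localPiSplitEquiv c J hc1 hJh w hw hJw).symm g) := fun g => by
    rw [hθ]; rfl
  have hθu : ∀ g, ‖((θ g : ℂˣ) : ℂ)‖ = 1 := fun g => by rw [hθ_apply]; exact hηu _
  have hθo : IsOpen ((θ.ker : Subgroup (GL (Fin 3) (w.1.adicCompletion E))) : Set (GL (Fin 3) (w.1.adicCompletion E))) := by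
    have hpre : ((θ.ker : Subgroup (GL (Fin 3) (w.1.adicCompletion E))) : Set (GL (Fin 3) (w.1.adicCompletion E))) =
        (fun g => (localPiSplitEquiv c J hc1 hJh w hw hJw).symm g) ⁻¹'
          ((η.ker : Subgroup (localPi E c 3 J v)) : Set (localPi E c 3 J v)) := by
      ext g
      rw [SetLike.mem_coe, MonoidHom.mem_ker, Set.mem_preimage, SetLike.mem_coe, MonoidHom.mem_ker, hθ_apply]
    rw [hpre]
    exact hηo.preimage (localPiSplitEquiv c J hc1 hJh w hw hJw).symm.continuous
  obtain ⟨θ₀, hθ₀, hθ₀u, hθ₀o⟩ := exists_eq_comp_det_of_character (N := 3) (by norm_num)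
    (exists_ne_zero_and_ne_one (w.1.adicCompletion E)) θ
  have hθ₀u' : ∀ t, ‖((θ₀ t : ℂˣ) : ℂ)‖ = 1 := hθ₀u hθu
  have hθ₀o' := hθ₀o hθo
  /- §3 the chain `I(ν, b₁) ≅ Θ_s(χ)∘κ⁻¹ ≅ θ ⊗ (Θ_s(χ′)∘κ⁻¹) ≅ θ ⊗ I(ν, b₂) = (θ₀∘det) ⊗ I(ν, b₂) ≅ I(νθ₀, b₂θ₀)` -/
  -- `Θ_s(χ) ∘ κ⁻¹ ≅ (η ⊗ Θ_s(χ′)) ∘ κ⁻¹ = θ ⊗ (Θ_s(χ′) ∘ κ⁻¹)` (pull `Θ_s(χ) ≅ η ⊗ Θ_s(χ′)` back along `κ⁻¹`)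
  have hA := areIsomorphicRep_comp_twist η hiso (localPiSplitEquiv c J hc1 hJh w hw hJw).symm.toMonoidHom θ hθ
  -- `θ ⊗ (Θ_s(χ′) ∘ κ⁻¹) ≅ (θ₀∘det) ⊗ I(ν, b₂) ≅ I(νθ₀, b₂θ₀)`
  have hB := areIsomorphicRep_twist_congr' h₂ θ _ hθ₀
  have hC := Zelevinsky1980.areIsomorphicRep_twist_det_parabolicIndGL_detChar (w.1.adicCompletion E) 3 ν
    (a₂ * ν ^ (1 - (3 : ℤ))) θ₀ hθ₀o'
  have hchain := ((h₁.symm.trans hA).trans hB).trans hC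
  /- §4 rigidity of the unitary inducing datum (`N = 3`): `ν = νθ₀`, hence `θ₀ = 1` and `η = 1` -/
  obtain ⟨hνeq, -⟩ := Zelevinsky1980.eq_of_areIsomorphicRep_parabolicIndGL_detChar (w.1.adicCompletion E) (n := 1)
    ν (a₁ * ν ^ (1 - (3 : ℤ))) (ν * θ₀) (a₂ * ν ^ (1 - (3 : ℤ)) * θ₀) le_rfl hνu hνc hb₁c
    (unitary_mul _ θ₀ hb₂u hθ₀u') hchain
  have hθ₀1 : θ₀ = 1 :=
    calc θ₀ = ν⁻¹ * (ν * θ₀) := (inv_mul_cancel_left ν θ₀).symm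
      _ = ν⁻¹ * ν := by rw [← hνeq]
      _ = 1 := inv_mul_cancel ν
  have hθ1 : ∀ g, θ g = 1 := fun g => by rw [hθ₀, hθ₀1, MonoidHom.one_comp, MonoidHom.one_apply]
  refine MonoidHom.ext fun g => ?_
  have := hθ1 (localPiSplitEquiv c J hc1 hJh w hw hJw g)
  rw [hθ_apply, ContinuousMulEquiv.symm_apply_apply] at this
  rw [this, MonoidHom.one_apply]

end Literature.RepresentationTheory.MoeglinVignerasWaldspurger1987

end
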